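import Summits.Ventures.HodgeRepro2.T5HeckeSimpleInvariants
import Summits.Ventures.HodgeRepro2.T5LevelIdempotentDual

/-!
# An irreducible representation is determined by its `K`-invariants as a Hecke module

Let `π`, `π'` be irreducible `K`-finite representations (char 0, every double coset `KgK/K`
finite) with `π^K ≠ 0`.  If there is an INJECTIVE `H(G, K)`-equivariant map `φ : π^K → π'^K`
(in particular if `π^K ≅ π'^K` as `H(G, K)`-modules) then `π ≅ π'`
(`nonempty_equiv_of_injective_heckeEquivariant`).  This is the injectivity half of the printed
bijection «irreducible smooth `π` with `π^K ≠ 0` ↔ simple `H(G, K)`-modules» (the converse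
direction of `T5HeckeSimpleInvariants`); the surjectivity half (every simple module arises) stays
prose.

PROOF.  Let `Γ ⊆ (π × π')^K` be the graph of `φ` — a Hecke-stable subspace — and `W ⊆ π × π'` the
`G`-span of `Γ`.  By `T5HeckeSimpleInvariants.map_gSpan_le` the `K`-fixed vectors of `W` lie in
`Γ`.  The kernel of the projection `W → π` is `W ∩ (0 × π')`, whose image in `π'` is `G`-stable,
hence `0` or `π'`; in the latter case `(0, φ v₀) ∈ W` is `K`-fixed, hence in `Γ`, forcing
`φ v₀ = φ 0 = 0`, against injectivity.  So `W → π` is injective, and surjective since its image is a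
non-zero `G`-stable subspace of the irreducible `π`.  Symmetrically `W → π'` is bijective, and
`π ≅ W ≅ π'` is `G`-equivariant because `W` is.
-/

namespace Summit.Ventures.HodgeRepro2.T5HeckeInvariantsDetermine

open T5HeckePermutationModule T5HeckeSimpleInvariants T5LevelIdempotent T5LevelIdempotentDual
  LevelPositivity

variable {G : Type*} [Group G] {k : Type*} [Field k]
  {V : Type*} [AddCommGroup V] [Module k V] {V' : Type*} [AddCommGroup V'] [Module k V']
  (ρ : Representation k G V) (ρ' : Representation k G V') {K : Subgroup G}

section Prod

/-- The product representation acts componentwise. -/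
theorem prod_apply' (g : G) (x : V × V') : (ρ.prod ρ') g x = (ρ g x.1, ρ' g x.2) := rfl

/-- `(v, v')` is `K`-fixed in `π × π'` iff both components are. -/
theorem mem_invariants_prod_iff {x : V × V'} :
    x ∈ invariants (ρ.prod ρ') K ↔ x.1 ∈ invariants ρ K ∧ x.2 ∈ invariants ρ' K := by
  simp only [mem_invariants_iff, prod_apply', Prod.ext_iff]
  exact ⟨fun h => ⟨fun g hg => (h g hg).1, fun g hg => (h g hg).2⟩,
    fun h g hg => ⟨h.1 g hg, h.2 g hg⟩⟩

/-- `K`-finiteness passes to products. -/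
theorem kFinite_prod (hK : KFinite ρ K) (hK' : KFinite ρ' K) : KFinite (ρ.prod ρ') K := by
  intro x
  haveI := hK x.1
  haveI := hK' x.2
  have hle : stabilizerIn ρ K x.1 ⊓ stabilizerIn ρ' K x.2 ≤ stabilizerIn (ρ.prod ρ') K x := by
    intro κ hκ
    rw [Subgroup.mem_inf, mem_stabilizerIn_iff, mem_stabilizerIn_iff] at hκ
    rw [mem_stabilizerIn_iff, prod_apply', hκ.1, hκ.2]
  exact Subgroup.finiteIndex_of_le hle

/-- The Frobenius map of the product is the product of the Frobenius maps. -/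
theorem orbitLinear_prod {x : V × V'} (hx : x ∈ invariants (ρ.prod ρ') K)
    (f : MonoidAlgebra k (G ⧸ K)) :
    orbitLinear (ρ.prod ρ') x hx f =
      (orbitLinear ρ x.1 ((mem_invariants_prod_iff ρ ρ').1 hx).1 f,
        orbitLinear ρ' x.2 ((mem_invariants_prod_iff ρ ρ').1 hx).2 f) := by
  have h : orbitLinear (ρ.prod ρ') x hx =
      (orbitLinear ρ x.1 ((mem_invariants_prod_iff ρ ρ').1 hx).1).prod
        (orbitLinear ρ' x.2 ((mem_invariants_prod_iff ρ ρ').1 hx).2) := by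
    apply MonoidAlgebra.lhom_ext'
    intro y
    apply LinearMap.ext
    intro c
    simp only [LinearMap.comp_apply, MonoidAlgebra.lsingle_apply, orbitLinear_single,
      LinearMap.prod_apply, Function.prod]
    induction y using QuotientGroup.induction_on with
    | H g => rw [orbitMap_mk, orbitMap_mk, orbitMap_mk, prod_apply', Prod.smul_mk]
  rw [h, LinearMap.prod_apply]
  rfl

/-- The Hecke action on `(π × π')^K` is componentwise. -/
theorem heckeSMul_prod (T : heckeAlgebra k K) (x : invariants (ρ.prod ρ') K) :
    (heckeSMul (ρ.prod ρ') T x : V × V') =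
      ((heckeSMul ρ T ⟨(x : V × V').1, ((mem_invariants_prod_iff ρ ρ').1 x.2).1⟩ : V),
        (heckeSMul ρ' T ⟨(x : V × V').2, ((mem_invariants_prod_iff ρ ρ').1 x.2).2⟩ : V')) := by
  rw [heckeSMul_coe, heckeSMul_coe, heckeSMul_coe, orbitLinear_prod]

end Prod

section Graph

variable (φ : invariants ρ K →ₗ[k] invariants ρ' K)

/-- The graph map `m ↦ (m, φ m)` into `(π × π')^K`. -/
noncomputable def graphMap : invariants ρ K →ₗ[k] invariants (ρ.prod ρ') K where
  toFun m := ⟨((m : V), (φ m : V')), (mem_invariants_prod_iff ρ ρ').2 ⟨m.2, (φ m).2⟩⟩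
  map_add' m₁ m₂ := by
    apply Subtype.ext
    simp only [Submodule.coe_add, map_add, Prod.mk_add_mk]
  map_smul' c m := by
    apply Subtype.ext
    simp only [Submodule.coe_smul, map_smul, Prod.smul_mk, RingHom.id_apply]

/-- The graph of `φ` as a subspace of `(π × π')^K`. -/
noncomputable def graph : Submodule k (invariants (ρ.prod ρ') K) := LinearMap.range (graphMap ρ ρ' φ)

/-- Membership in the graph: `x = (m, φ m)` for some `m ∈ π^K`. -/
theorem mem_graph_iff (x : invariants (ρ.prod ρ') K) :
    x ∈ graph ρ ρ' φ ↔ ∃ m : invariants ρ K, ((m : V), (φ m : V')) = (x : V × V') := by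
  unfold graph
  rw [LinearMap.mem_range]
  constructor
  · rintro ⟨m, hm⟩
    exact ⟨m, congrArg Subtype.val hm⟩
  · rintro ⟨m, hm⟩
    exact ⟨m, Subtype.ext hm⟩

/-- The graph of a Hecke-equivariant map is Hecke-stable. -/
theorem isHeckeSubmodule_graph
    (hφ : ∀ (T : heckeAlgebra k K) (m : invariants ρ K), φ (heckeSMul ρ T m) = heckeSMul ρ' T (φ m)) :
    IsHeckeSubmodule (ρ.prod ρ') (graph ρ ρ' φ) := by
  intro T x hx
  rw [mem_graph_iff] at hx ⊢
  obtain ⟨m, hm⟩ := hx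
  refine ⟨heckeSMul ρ T m, ?_⟩
  rw [heckeSMul_prod, hφ]
  congr 2 <;> apply Subtype.ext <;> simp only [← hm]

end Graph

section Main

variable [CharZero k] [ρ.IsIrreducible] [ρ'.IsIrreducible]

omit [CharZero k] in
/-- A `G`-stable subspace of an irreducible representation is `⊥` or `⊤`. -/
theorem eq_bot_or_eq_top_of_stable {S : Submodule k V} (hS : ∀ (g : G) ⦃v : V⦄, v ∈ S → ρ g v ∈ S) :
    S = ⊥ ∨ S = ⊤ := by
  rcases eq_bot_or_eq_top (⟨S, hS⟩ : Subrepresentation ρ) with h | h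
  · exact Or.inl (congrArg Subrepresentation.toSubmodule h)
  · exact Or.inr (congrArg Subrepresentation.toSubmodule h)

variable (φ : invariants ρ K →ₗ[k] invariants ρ' K)

omit [ρ.IsIrreducible] [ρ'.IsIrreducible] in
/-- A `K`-fixed vector of the `G`-span of the graph lies in the graph. -/
theorem mem_graph_of_mem_gSpan (hK : KFinite ρ K) (hK' : KFinite ρ' K)
    (hfin : ∀ g : G, Finite (MulAction.orbit K (g : G ⧸ K)))
    (hφ : ∀ (T : heckeAlgebra k K) (m : invariants ρ K), φ (heckeSMul ρ T m) = heckeSMul ρ' T (φ m))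
    {w : V × V'} (hw : w ∈ gSpan (ρ.prod ρ') (graph ρ ρ' φ))
    (hwK : w ∈ invariants (ρ.prod ρ') K) : (⟨w, hwK⟩ : invariants (ρ.prod ρ') K) ∈ graph ρ ρ' φ := by
  have h := map_gSpan_le (ρ.prod ρ') (kFinite_prod ρ ρ' hK hK') hfin (isHeckeSubmodule_graph ρ ρ' φ hφ)
  have hmem : levelIdempotentTo (ρ.prod ρ') (kFinite_prod ρ ρ' hK hK') w ∈
      Submodule.map (levelIdempotentTo (ρ.prod ρ') (kFinite_prod ρ ρ' hK hK'))
        (gSpan (ρ.prod ρ') (graph ρ ρ' φ)) :=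
    Submodule.mem_map_of_mem hw
  have he : levelIdempotentTo (ρ.prod ρ') (kFinite_prod ρ ρ' hK hK') w = ⟨w, hwK⟩ := by
    apply Subtype.ext
    rw [levelIdempotentTo_apply, levelAverage_of_mem_invariants hwK]
  rw [he] at hmem
  exact h hmem

omit [ρ.IsIrreducible] in
/-- The first projection of the `G`-span of the graph is injective. -/
theorem fst_injective_gSpan (hK : KFinite ρ K) (hK' : KFinite ρ' K)
    (hfin : ∀ g : G, Finite (MulAction.orbit K (g : G ⧸ K))) (hφinj : Function.Injective φ)
    (hφ : ∀ (T : heckeAlgebra k K) (m : invariants ρ K), φ (heckeSMul ρ T m) = heckeSMul ρ' T (φ m))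
    {v₀ : invariants ρ K} (hv₀ : v₀ ≠ 0) {w : V × V'}
    (hw : w ∈ gSpan (ρ.prod ρ') (graph ρ ρ' φ)) (h1 : w.1 = 0) : w = 0 := by
  -- the kernel of the first projection, and its image in `π'`
  let N : Submodule k (V × V') :=
    gSpan (ρ.prod ρ') (graph ρ ρ' φ) ⊓ LinearMap.ker (LinearMap.fst k V V')
  let N₂ : Submodule k V' := N.map (LinearMap.snd k V V')
  have hN₂ : ∀ (g : G) ⦃u : V'⦄, u ∈ N₂ → ρ' g u ∈ N₂ := by
    intro g u hu
    rw [Submodule.mem_map] at hu ⊢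
    obtain ⟨n, hn, rfl⟩ := hu
    refine ⟨(ρ.prod ρ') g n, ?_, rfl⟩
    rw [Submodule.mem_inf, LinearMap.mem_ker] at hn ⊢
    refine ⟨apply_mem_gSpan _ _ g hn.1, ?_⟩
    rw [prod_apply', LinearMap.fst_apply]
    simp only [LinearMap.fst_apply] at hn
    rw [hn.2, map_zero]
  rcases eq_bot_or_eq_top_of_stable ρ' hN₂ with hbot | htop
  · -- `N₂ = 0`: every element of `N` has both components zero
    have hwN : w ∈ N := by
      rw [Submodule.mem_inf, LinearMap.mem_ker]
      exact ⟨hw, h1⟩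
    have h2 : w.2 ∈ N₂ := Submodule.mem_map_of_mem hwN
    rw [hbot, Submodule.mem_bot] at h2
    exact Prod.ext h1 h2
  · -- `N₂ = π'`: `(0, φ v₀)` is a `K`-fixed vector of `W`, hence lies in the graph — contradiction
    exfalso
    have hmem : (φ v₀ : V') ∈ N₂ := by rw [htop]; exact Submodule.mem_top
    rw [Submodule.mem_map] at hmem
    obtain ⟨n, hn, hn2⟩ := hmem
    rw [Submodule.mem_inf, LinearMap.mem_ker] at hn
    have hn' : n = ((0 : V), (φ v₀ : V')) := by
      apply Prod.ext
      · exact hn.2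
      · exact hn2
    have hnK : n ∈ invariants (ρ.prod ρ') K := by
      rw [hn', mem_invariants_prod_iff]
      exact ⟨Submodule.zero_mem _, (φ v₀).2⟩
    have hg := mem_graph_of_mem_gSpan ρ ρ' φ hK hK' hfin hφ hn.1 hnK
    rw [mem_graph_iff] at hg
    obtain ⟨m, hm⟩ := hg
    simp only [hn', Prod.ext_iff] at hm
    have hm0 : m = 0 := Subtype.ext hm.1
    have : φ v₀ = 0 := by
      apply Subtype.ext
      rw [← hm.2, hm0, map_zero]
    exact hv₀ (hφinj (this.trans (map_zero φ).symm))

omit [ρ'.IsIrreducible] in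
/-- The second projection of the `G`-span of the graph is injective. -/
theorem snd_injective_gSpan (hK : KFinite ρ K) (hK' : KFinite ρ' K)
    (hfin : ∀ g : G, Finite (MulAction.orbit K (g : G ⧸ K))) (hφinj : Function.Injective φ)
    (hφ : ∀ (T : heckeAlgebra k K) (m : invariants ρ K), φ (heckeSMul ρ T m) = heckeSMul ρ' T (φ m))
    {v₀ : invariants ρ K} (hv₀ : v₀ ≠ 0) {w : V × V'}
    (hw : w ∈ gSpan (ρ.prod ρ') (graph ρ ρ' φ)) (h2 : w.2 = 0) : w = 0 := by
  let N : Submodule k (V × V') :=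
    gSpan (ρ.prod ρ') (graph ρ ρ' φ) ⊓ LinearMap.ker (LinearMap.snd k V V')
  let N₁ : Submodule k V := N.map (LinearMap.fst k V V')
  have hN₁ : ∀ (g : G) ⦃u : V⦄, u ∈ N₁ → ρ g u ∈ N₁ := by
    intro g u hu
    rw [Submodule.mem_map] at hu ⊢
    obtain ⟨n, hn, rfl⟩ := hu
    refine ⟨(ρ.prod ρ') g n, ?_, rfl⟩
    rw [Submodule.mem_inf, LinearMap.mem_ker] at hn ⊢
    refine ⟨apply_mem_gSpan _ _ g hn.1, ?_⟩
    rw [prod_apply', LinearMap.snd_apply]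
    simp only [LinearMap.snd_apply] at hn
    rw [hn.2, map_zero]
  rcases eq_bot_or_eq_top_of_stable ρ hN₁ with hbot | htop
  · have hwN : w ∈ N := by
      rw [Submodule.mem_inf, LinearMap.mem_ker]
      exact ⟨hw, h2⟩
    have h1 : w.1 ∈ N₁ := Submodule.mem_map_of_mem hwN
    rw [hbot, Submodule.mem_bot] at h1
    exact Prod.ext h1 h2
  · exfalso
    have hmem : (v₀ : V) ∈ N₁ := by rw [htop]; exact Submodule.mem_top
    rw [Submodule.mem_map] at hmem
    obtain ⟨n, hn, hn1⟩ := hmem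
    rw [Submodule.mem_inf, LinearMap.mem_ker] at hn
    have hn' : n = ((v₀ : V), (0 : V')) := by
      apply Prod.ext
      · exact hn1
      · exact hn.2
    have hnK : n ∈ invariants (ρ.prod ρ') K := by
      rw [hn', mem_invariants_prod_iff]
      exact ⟨v₀.2, Submodule.zero_mem _⟩
    have hg := mem_graph_of_mem_gSpan ρ ρ' φ hK hK' hfin hφ hn.1 hnK
    rw [mem_graph_iff] at hg
    obtain ⟨m, hm⟩ := hg
    simp only [hn', Prod.ext_iff] at hm
    have hm0 : m = v₀ := Subtype.ext hm.1
    have : φ v₀ = 0 := by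
      apply Subtype.ext
      rw [← hm0, hm.2]
      rfl
    exact hv₀ (hφinj (this.trans (map_zero φ).symm))

omit [CharZero k] [ρ.IsIrreducible] [ρ'.IsIrreducible] in
/-- The graph map lands in the `G`-span of the graph. -/
theorem graphMap_mem_gSpan (m : invariants ρ K) :
    (((m : V), (φ m : V')) : V × V') ∈ gSpan (ρ.prod ρ') (graph ρ ρ' φ) := by
  apply le_gSpan (ρ.prod ρ') (graph ρ ρ' φ)
  rw [Submodule.mem_map]
  exact ⟨graphMap ρ ρ' φ m, LinearMap.mem_range_self _ m, rfl⟩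

omit [CharZero k] [ρ'.IsIrreducible] in
/-- The first projection of the `G`-span of the graph is surjective. -/
theorem fst_surjective_gSpan {v₀ : invariants ρ K} (hv₀ : v₀ ≠ 0) (v : V) :
    ∃ w ∈ gSpan (ρ.prod ρ') (graph ρ ρ' φ), w.1 = v := by
  let S : Submodule k V := (gSpan (ρ.prod ρ') (graph ρ ρ' φ)).map (LinearMap.fst k V V')
  have hS : ∀ (g : G) ⦃u : V⦄, u ∈ S → ρ g u ∈ S := by
    intro g u hu
    rw [Submodule.mem_map] at hu ⊢
    obtain ⟨n, hn, rfl⟩ := hu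
    exact ⟨(ρ.prod ρ') g n, apply_mem_gSpan _ _ g hn, rfl⟩
  rcases eq_bot_or_eq_top_of_stable ρ hS with hbot | htop
  · exfalso
    have : (v₀ : V) ∈ S :=
      Submodule.mem_map_of_mem (f := LinearMap.fst k V V') (graphMap_mem_gSpan ρ ρ' φ v₀)
    rw [hbot, Submodule.mem_bot] at this
    exact hv₀ (Subtype.ext this)
  · have : v ∈ S := by rw [htop]; exact Submodule.mem_top
    rw [Submodule.mem_map] at this
    obtain ⟨w, hw, hw1⟩ := this
    exact ⟨w, hw, hw1⟩

omit [CharZero k] [ρ.IsIrreducible] in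
/-- The second projection of the `G`-span of the graph is surjective. -/
theorem snd_surjective_gSpan (hφinj : Function.Injective φ) {v₀ : invariants ρ K} (hv₀ : v₀ ≠ 0)
    (v' : V') :
    ∃ w ∈ gSpan (ρ.prod ρ') (graph ρ ρ' φ), w.2 = v' := by
  let S : Submodule k V' := (gSpan (ρ.prod ρ') (graph ρ ρ' φ)).map (LinearMap.snd k V V')
  have hS : ∀ (g : G) ⦃u : V'⦄, u ∈ S → ρ' g u ∈ S := by
    intro g u hu
    rw [Submodule.mem_map] at hu ⊢
    obtain ⟨n, hn, rfl⟩ := hu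
    exact ⟨(ρ.prod ρ') g n, apply_mem_gSpan _ _ g hn, rfl⟩
  rcases eq_bot_or_eq_top_of_stable ρ' hS with hbot | htop
  · exfalso
    have : (φ v₀ : V') ∈ S :=
      Submodule.mem_map_of_mem (f := LinearMap.snd k V V') (graphMap_mem_gSpan ρ ρ' φ v₀)
    rw [hbot, Submodule.mem_bot] at this
    exact hv₀ (hφinj ((Subtype.ext this).trans (map_zero φ).symm))
  · have : v' ∈ S := by rw [htop]; exact Submodule.mem_top
    rw [Submodule.mem_map] at this
    obtain ⟨w, hw, hw2⟩ := this
    exact ⟨w, hw, hw2⟩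

omit [CharZero k] [ρ.IsIrreducible] [ρ'.IsIrreducible] in
/-- The two projections of the `G`-span `W` of the graph, as linear maps on `W`. -/
noncomputable def projFst : gSpan (ρ.prod ρ') (graph ρ ρ' φ) →ₗ[k] V :=
  (LinearMap.fst k V V').comp (gSpan (ρ.prod ρ') (graph ρ ρ' φ)).subtype

omit [CharZero k] [ρ.IsIrreducible] [ρ'.IsIrreducible] in
/-- The second projection of the `G`-span `W` of the graph, as a linear map on `W`. -/
noncomputable def projSnd : gSpan (ρ.prod ρ') (graph ρ ρ' φ) →ₗ[k] V' :=
  (LinearMap.snd k V V').comp (gSpan (ρ.prod ρ') (graph ρ ρ' φ)).subtype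

/-- The first projection `W → π` is bijective. -/
theorem projFst_bijective (hK : KFinite ρ K) (hK' : KFinite ρ' K)
    (hfin : ∀ g : G, Finite (MulAction.orbit K (g : G ⧸ K))) (hφinj : Function.Injective φ)
    (hφ : ∀ (T : heckeAlgebra k K) (m : invariants ρ K), φ (heckeSMul ρ T m) = heckeSMul ρ' T (φ m))
    {v₀ : invariants ρ K} (hv₀ : v₀ ≠ 0) :
    Function.Bijective (projFst ρ ρ' φ) := by
  constructor
  · intro w₁ w₂ h
    apply Subtype.ext
    have h' : ((w₁ : V × V') - w₂).1 = 0 := by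
      rw [Prod.fst_sub, sub_eq_zero]
      exact h
    have := fst_injective_gSpan ρ ρ' φ hK hK' hfin hφinj hφ hv₀
      (Submodule.sub_mem _ w₁.2 w₂.2) h'
    exact sub_eq_zero.1 this
  · intro v
    obtain ⟨w, hw, hw1⟩ := fst_surjective_gSpan ρ ρ' φ hv₀ v
    exact ⟨⟨w, hw⟩, hw1⟩

/-- The second projection `W → π'` is bijective. -/
theorem projSnd_bijective (hK : KFinite ρ K) (hK' : KFinite ρ' K)
    (hfin : ∀ g : G, Finite (MulAction.orbit K (g : G ⧸ K))) (hφinj : Function.Injective φ)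
    (hφ : ∀ (T : heckeAlgebra k K) (m : invariants ρ K), φ (heckeSMul ρ T m) = heckeSMul ρ' T (φ m))
    {v₀ : invariants ρ K} (hv₀ : v₀ ≠ 0) :
    Function.Bijective (projSnd ρ ρ' φ) := by
  constructor
  · intro w₁ w₂ h
    apply Subtype.ext
    have h' : ((w₁ : V × V') - w₂).2 = 0 := by
      rw [Prod.snd_sub, sub_eq_zero]
      exact h
    have := snd_injective_gSpan ρ ρ' φ hK hK' hfin hφinj hφ hv₀
      (Submodule.sub_mem _ w₁.2 w₂.2) h'
    exact sub_eq_zero.1 this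
  · intro v'
    obtain ⟨w, hw, hw2⟩ := snd_surjective_gSpan ρ ρ' φ hφinj hv₀ v'
    exact ⟨⟨w, hw⟩, hw2⟩

/-- THE ISOMORPHISM `π ≅ π'`: an irreducible `K`-finite representation with `π^K ≠ 0` is determined
by its `K`-invariants as a Hecke module — an injective `H(G, K)`-equivariant map `π^K → π'^K` into
the `K`-invariants of another irreducible `K`-finite representation forces `π ≅ π'`. -/
theorem nonempty_equiv_of_injective_heckeEquivariant (hK : KFinite ρ K) (hK' : KFinite ρ' K)
    (hfin : ∀ g : G, Finite (MulAction.orbit K (g : G ⧸ K))) (hφinj : Function.Injective φ)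
    (hφ : ∀ (T : heckeAlgebra k K) (m : invariants ρ K), φ (heckeSMul ρ T m) = heckeSMul ρ' T (φ m))
    {v₀ : invariants ρ K} (hv₀ : v₀ ≠ 0) :
    Nonempty (ρ.Equiv ρ') := by
  let e₁ := LinearEquiv.ofBijective _ (projFst_bijective ρ ρ' φ hK hK' hfin hφinj hφ hv₀)
  let e₂ := LinearEquiv.ofBijective _ (projSnd_bijective ρ ρ' φ hK hK' hfin hφinj hφ hv₀)
  refine ⟨Representation.Equiv.mk (e₁.symm.trans e₂) fun g => ?_⟩
  apply LinearMap.ext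
  intro v
  simp only [LinearMap.comp_apply, LinearEquiv.coe_coe, LinearEquiv.trans_apply]
  -- `w := e₁.symm v` is the element `(v, Φ v)` of `W`
  set w := e₁.symm v with hw
  have hw1 : (w : V × V').1 = v := by
    have := e₁.apply_symm_apply v
    rw [← hw] at this
    exact this
  have hgw : (ρ.prod ρ') g (w : V × V') ∈ gSpan (ρ.prod ρ') (graph ρ ρ' φ) :=
    apply_mem_gSpan _ _ g w.2
  have hfst : e₁ ⟨(ρ.prod ρ') g (w : V × V'), hgw⟩ = ρ g v := by
    show (LinearMap.fst k V V') ((ρ.prod ρ') g (w : V × V')) = ρ g v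
    rw [LinearMap.fst_apply, prod_apply', hw1]
  have hsymm : e₁.symm (ρ g v) = ⟨(ρ.prod ρ') g (w : V × V'), hgw⟩ := by
    rw [← hfst, LinearEquiv.symm_apply_apply]
  rw [hsymm]
  show (LinearMap.snd k V V') ((ρ.prod ρ') g (w : V × V')) = ρ' g ((LinearMap.snd k V V') (w : V × V'))
  rw [LinearMap.snd_apply, LinearMap.snd_apply, prod_apply']

end Main

end Summit.Ventures.HodgeRepro2.T5HeckeInvariantsDetermine
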